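import Mathlib

/-!
# Ladder extraction (abstract discrete intermediate-value argument)

Abstract form of Bresler–Huang (arXiv:2106.02129), Proposition 4.6: along a path `x : ℕ → V` of
length `k * W`, a prefix-local potential `h` that moves by at most `δ` per step, vanishes on a
repeated rung and exceeds `bp` one window `W` after all earlier rungs admits rung times
`ts 0 = 0 < ts 1 < ⋯ < ts k` with consecutive gaps `≤ W` such that every rung `ℓ ≥ 1` has
potential in `[bm, bp]` given its predecessors.
-/

namespace Summit.PneNP.PneNP.Cruxes.NoStableSection.DartGame
set_option linter.dupNamespace false

/-! ## Ladder extraction -/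

/-- Gap bounds `ts (i+1) ≤ ts i + W` for `i < ℓ` together with `ts 0 = 0` give `ts i ≤ i * W`
for all `i ≤ ℓ`. -/
theorem ladder_le_mul {ts : ℕ → ℕ} {W ℓ : ℕ} (h0 : ts 0 = 0)
    (hgap : ∀ i < ℓ, ts i < ts (i + 1) ∧ ts (i + 1) ≤ ts i + W) :
    ∀ i ≤ ℓ, ts i ≤ i * W := by
  intro i hi
  induction i with
  | zero => simp [h0]
  | succ i ih =>
    have h1 := (hgap i (by omega)).2
    have h2 := ih (by omega)
    calc ts (i + 1) ≤ ts i + W := h1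
      _ ≤ i * W + W := by omega
      _ = (i + 1) * W := by ring

/-- Gap bounds `ts i < ts (i+1)` for `i < ℓ` give monotonicity `ts i ≤ ts m` for `i ≤ m ≤ ℓ`. -/
theorem ladder_mono {ts : ℕ → ℕ} {W ℓ : ℕ}
    (hgap : ∀ i < ℓ, ts i < ts (i + 1) ∧ ts (i + 1) ≤ ts i + W) :
    ∀ m ≤ ℓ, ∀ i ≤ m, ts i ≤ ts m := by
  intro m
  induction m with
  | zero => intro _ i hi; rw [Nat.le_zero.mp hi]
  | succ m ih =>
    intro hm i hi
    rcases Nat.lt_or_ge i (m + 1) with h | h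
    · exact (ih (by omega) i (by omega)).trans (hgap m (by omega)).1.le
    · rw [le_antisymm hi h]

/-- Discrete intermediate value: if `f a ≤ bm ≤ f (a + 1 + n)` and `f` increases by at most `δ`
per step on `[a, a + n]`, then some `s ∈ (a, a + 1 + n]` has `bm ≤ f s ≤ bm + δ` (take the first
`s > a` with `bm ≤ f s`). -/
theorem ladder_ivt {f : ℕ → ℝ} {a n : ℕ} {δ bm : ℝ}
    (ha : f a ≤ bm) (hb : bm ≤ f (a + 1 + n))
    (hlip : ∀ t ≤ a + n, f (t + 1) ≤ f t + δ) :
    ∃ s, a < s ∧ s ≤ a + 1 + n ∧ bm ≤ f s ∧ f s ≤ bm + δ := by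
  classical
  have hex : ∃ d, bm ≤ f (a + 1 + d) := ⟨n, hb⟩
  obtain ⟨d₀, hd₀spec, hd₀min, hd₀le⟩ : ∃ d₀, bm ≤ f (a + 1 + d₀) ∧
      (∀ d < d₀, f (a + 1 + d) < bm) ∧ d₀ ≤ n :=
    ⟨Nat.find hex, Nat.find_spec hex, fun d hd => not_le.mp (Nat.find_min hex hd),
      Nat.find_min' hex hb⟩
  refine ⟨a + 1 + d₀, by omega, by omega, hd₀spec, ?_⟩
  have hprev : f (a + d₀) ≤ bm := by
    rcases d₀ with _ | d
    · simpa using ha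
    · have h1 := hd₀min d (Nat.lt_succ_self d)
      have h2 : a + (d + 1) = a + 1 + d := by omega
      rw [h2]
      exact h1.le
  have hstep := hlip (a + d₀) (by omega)
  have h3 : a + 1 + d₀ = a + d₀ + 1 := by omega
  rw [h3]
  linarith

/-- The inductive step of the ladder extraction: given rung times `ts 0, …, ts ℓ` with the gap
bounds and `ℓ + 1 ≤ k`, there is a next rung time `s ∈ (ts ℓ, ts ℓ + W]` whose potential given
the first `ℓ + 1` rungs lies in `[bm, bp]`. -/
theorem ladder_step {V : Type} {k W : ℕ} {x : ℕ → V} {h : (ℕ → V) → ℕ → V → ℝ}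
    {δ bm bp : ℝ} (hW : 0 < W) (hbm : 0 ≤ bm) (hδ : δ ≤ bp - bm)
    (hrep : ∀ (R : ℕ → V) (ℓ : ℕ) (v : V), (∃ j < ℓ, R j = v) → h R ℓ v = 0)
    (hlip : ∀ (R : ℕ → V) (ℓ t : ℕ), t < k * W → |h R ℓ (x (t + 1)) - h R ℓ (x t)| ≤ δ)
    (hind : ∀ (ℓ : ℕ) (ts : ℕ → ℕ) (t : ℕ), 1 ≤ ℓ → ℓ ≤ k → (∀ j < ℓ, ts j + W ≤ t) →
      t ≤ k * W → bp < h (fun j => x (ts j)) ℓ (x t))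
    {ℓ : ℕ} {ts : ℕ → ℕ} (hℓk : ℓ + 1 ≤ k) (h0 : ts 0 = 0)
    (hgap : ∀ i < ℓ, ts i < ts (i + 1) ∧ ts (i + 1) ≤ ts i + W) :
    ∃ s, ts ℓ < s ∧ s ≤ ts ℓ + W ∧ h (fun j => x (ts j)) (ℓ + 1) (x s) ∈ Set.Icc bm bp := by
  have hts_le : ts ℓ ≤ ℓ * W := ladder_le_mul h0 hgap ℓ le_rfl
  have ht' : ts ℓ + W ≤ k * W := by
    calc ts ℓ + W ≤ ℓ * W + W := by omega
      _ = (ℓ + 1) * W := by ring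
      _ ≤ k * W := Nat.mul_le_mul_right _ hℓk
  -- the potential of the candidate `x s` given the first `ℓ + 1` rungs
  set f : ℕ → ℝ := fun s => h (fun j => x (ts j)) (ℓ + 1) (x s) with hf
  -- it vanishes at the last rung time
  have hf0 : f (ts ℓ) = 0 := hrep _ _ _ ⟨ℓ, Nat.lt_succ_self ℓ, rfl⟩
  -- and exceeds `bp` one window later
  have hft' : bp < f (ts ℓ + W) := by
    refine hind (ℓ + 1) ts (ts ℓ + W) (by omega) hℓk ?_ ht'
    intro j hj
    have := ladder_mono hgap ℓ le_rfl j (by omega)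
    omega
  -- one-step increments are at most `δ` up to time `ts ℓ + W ≤ k * W`
  have hlip' : ∀ t ≤ ts ℓ + (W - 1), f (t + 1) ≤ f t + δ := by
    intro t ht
    have habs : |f (t + 1) - f t| ≤ δ := hlip (fun j => x (ts j)) (ℓ + 1) t (by omega)
    have := (abs_le.mp habs).2
    linarith
  have hδ0 : 0 ≤ δ := by
    have habs : |f (ts ℓ + 1) - f (ts ℓ)| ≤ δ := hlip (fun j => x (ts j)) (ℓ + 1) (ts ℓ) (by omega)
    exact (abs_nonneg _).trans habs
  have hb : bm ≤ f (ts ℓ + 1 + (W - 1)) := by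
    have h1 : ts ℓ + 1 + (W - 1) = ts ℓ + W := by omega
    rw [h1]
    linarith
  obtain ⟨s, hs1, hs2, hs3, hs4⟩ := ladder_ivt (hf0.le.trans hbm) hb hlip'
  exact ⟨s, hs1, by omega, hs3, show f s ≤ bp by linarith⟩

/-- **Ladder extraction** (abstract form of Bresler–Huang, arXiv:2106.02129, Proposition 4.6).
Along a path `x : ℕ → V` of length `k * W`, let `h R ℓ v` be a potential of the candidate `v`
given the first `ℓ` rungs of `R`, local in that prefix, vanishing when `v` repeats an earlier
rung, moving by at most `δ ≤ bp - bm` between consecutive path points, and exceeding `bp` whenever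
the time is at least one window `W` after all earlier rung times. Then there are rung times
`ts 0 = 0 < ts 1 < ⋯ < ts k` with consecutive gaps at most `W` such that every rung `ℓ ≥ 1` has
potential in `[bm, bp]` given its predecessors (discrete intermediate-value argument, by
recursion on `ℓ`). -/
theorem stub_ladderExtraction :
  ∀ (V : Type) (k W : ℕ) (x : ℕ → V) (h : (ℕ → V) → ℕ → V → ℝ) (δ bm bp : ℝ),
    0 < W → 0 ≤ bm → δ ≤ bp - bm →
    (∀ (R R' : ℕ → V) (ℓ : ℕ) (v : V), (∀ j < ℓ, R j = R' j) → h R ℓ v = h R' ℓ v) →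
    (∀ (R : ℕ → V) (ℓ : ℕ) (v : V), (∃ j < ℓ, R j = v) → h R ℓ v = 0) →
    (∀ (R : ℕ → V) (ℓ t : ℕ), t < k * W → |h R ℓ (x (t + 1)) - h R ℓ (x t)| ≤ δ) →
    (∀ (ℓ : ℕ) (ts : ℕ → ℕ) (t : ℕ), 1 ≤ ℓ → ℓ ≤ k → (∀ j < ℓ, ts j + W ≤ t) → t ≤ k * W →
        bp < h (fun j => x (ts j)) ℓ (x t)) →
    ∃ ts : ℕ → ℕ, ts 0 = 0 ∧ (∀ ℓ < k, ts ℓ < ts (ℓ + 1) ∧ ts (ℓ + 1) ≤ ts ℓ + W) ∧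
      ∀ ℓ, 1 ≤ ℓ → ℓ ≤ k → h (fun j => x (ts j)) ℓ (x (ts ℓ)) ∈ Set.Icc bm bp := by
  intro V k W x h δ bm bp hW hbm hδ hloc hrep hlip hind
  suffices H : ∀ ℓ ≤ k, ∃ ts : ℕ → ℕ, ts 0 = 0 ∧
      (∀ i < ℓ, ts i < ts (i + 1) ∧ ts (i + 1) ≤ ts i + W) ∧
      ∀ i, 1 ≤ i → i ≤ ℓ → h (fun j => x (ts j)) i (x (ts i)) ∈ Set.Icc bm bp from
    H k le_rfl
  intro ℓ
  induction ℓ with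
  | zero =>
    intro _
    exact ⟨fun _ => 0, rfl, fun i hi => absurd hi (Nat.not_lt_zero _),
      fun i h1 h2 => absurd (h1.trans h2) (by norm_num)⟩
  | succ ℓ ih =>
    intro hℓk
    obtain ⟨ts, h0, hgap, hval⟩ := ih (by omega)
    obtain ⟨s₀, hs₀lt, hs₀le, hs₀val⟩ :=
      ladder_step hW hbm hδ hrep hlip hind hℓk h0 hgap
    refine ⟨Function.update ts (ℓ + 1) s₀, ?_, ?_, ?_⟩
    · rw [Function.update_of_ne (by omega : (0 : ℕ) ≠ ℓ + 1)]
      exact h0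
    · intro i hi
      rcases Nat.lt_or_ge i ℓ with hil | hil
      · rw [Function.update_of_ne (by omega : i ≠ ℓ + 1),
          Function.update_of_ne (by omega : i + 1 ≠ ℓ + 1)]
        exact hgap i hil
      · obtain rfl : i = ℓ := by omega
        rw [Function.update_self, Function.update_of_ne (by omega : i ≠ i + 1)]
        exact ⟨hs₀lt, hs₀le⟩
    · intro i h1i hi
      have key : h (fun j => x (Function.update ts (ℓ + 1) s₀ j)) i
          = h (fun j => x (ts j)) i := by
        funext v
        refine hloc _ _ i v ?_
        intro j hj
        rw [Function.update_of_ne (by omega : j ≠ ℓ + 1)]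
      rw [key]
      rcases Nat.lt_or_ge i (ℓ + 1) with hil | hil
      · rw [Function.update_of_ne (by omega : i ≠ ℓ + 1)]
        exact hval i h1i (by omega)
      · rw [le_antisymm hi hil, Function.update_self]
        exact hs₀val

end Summit.PneNP.PneNP.Cruxes.NoStableSection.DartGame
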